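import Summits.Ventures.PercRepro.C041BlockMapForest
import Summits.Ventures.PercRepro.C041BlockMapUnit
import Summits.Ventures.PercRepro.C041MultiExitCoincident

/-!
# ROW C-041 — THEOREM (EXIT FAMILIES): the block map of a family of exits pulled back along any map of indices is the
block map at the products over the fibres; CONJECTURE (BLOCK MAP) depends only on the SET of exits (p6, gen 37)

For a host `Z₁` with exits `u : ι → V₁` and a map `f : ι' → ι`, the family `u ∘ f` has several exits at the vertex
`u k` (those of the fibre `f⁻¹ k`) and none at the vertices `u k` with an empty fibre.  **THEOREM (EXIT FAMILIES)**
(`blockMap_comp`): `blockMap Z₁ (u ∘ f) a₁ w = blockMap Z₁ u a₁ (pull f w)` with `pull f w k = ∏_{j ∈ f⁻¹ k} w j`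
(the empty product `𝟙` for an empty fibre).  PROOF, colouring by colouring (`colTerm_comp`): an exit `j` of `u ∘ f` is
merged iff `f j` is (`mem_merged_comp`), its block is the preimage of the block of `f j` (`blk_comp`), the blocks of
`u ∘ f` are the nonempty preimages of the blocks of `u` (`blocks_comp`); the merged product and each block product
regroup along the fibres (`Finset.prod_fiberwise_of_maps_to`, `exitOf_prod`), the blocks with an empty preimage
contribute `θ_R 𝟙 = 𝟙`, and the preimage map is injective on the blocks with a nonempty preimage (the blocks are
pairwise disjoint).  CONSEQUENCES: `coneHost_comp : ConeHost Z₁ u a₁ → ConeHost Z₁ (u ∘ f) a₁` — a cone host stays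
one under any re-indexing, identification, multiplication or omission of exits (THEOREM (UNIT EXIT), THEOREM
(COINCIDENT EXITS) and `coneHost_reindex` are the cases `f = some`, `f = const`, `f` a bijection); hence
`coneHostAll_iff_id : ConeHostAll Z₁ a₁ ↔ ConeHost Z₁ id a₁` — CONJECTURE (BLOCK MAP) for every family of exits is
its instance with EVERY VERTEX AN EXIT, ONCE: one statement per host and anchor.
-/

namespace PercRepro

namespace ZoneZ

namespace MultiExit

open ZoneData Pendant Finset TwoExit TreeClosure

variable {ι ι' V₁ E₁ U₁ U₂ : Type} (Z₁ : ZoneData V₁ E₁ U₁ U₂) (u : ι → V₁) (a₁ : V₁) (f : ι' → ι)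
variable [Fintype ι] [DecidableEq ι] [Fintype ι'] [DecidableEq ι'] [Fintype E₁] [DecidableEq E₁]

/-! ## The fibres -/

/-- The fibre of `k` under `f`. -/
def fibre (k : ι) : Finset ι' := univ.filter fun j => f j = k

/-- The preimage of a set of exits. -/
def pre (B : Finset ι) : Finset ι' := univ.filter fun j => f j ∈ B

/-- The products over the fibres. -/
def pull (w : ι' → Vec6) : ι → Vec6 := fun k => ∏ j ∈ fibre f k, w j

omit [Fintype ι] [DecidableEq ι'] in
/-- Membership in a preimage. -/
theorem mem_pre (B : Finset ι) (j : ι') : j ∈ pre f B ↔ f j ∈ B := by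
  unfold pre
  rw [Finset.mem_filter]
  exact and_iff_right (Finset.mem_univ _)

omit [Fintype ι] [DecidableEq ι'] in
/-- Membership in a fibre. -/
theorem mem_fibre (k : ι) (j : ι') : j ∈ fibre f k ↔ f j = k := by
  unfold fibre
  rw [Finset.mem_filter]
  exact and_iff_right (Finset.mem_univ _)

omit [Fintype ι] [DecidableEq ι'] in
/-- A product over a preimage regroups along the fibres. -/
theorem prod_pre (B : Finset ι) (g : ι' → Vec6) : ∏ j ∈ pre f B, g j = ∏ k ∈ B, ∏ j ∈ fibre f k, g j := by
  rw [← Finset.prod_fiberwise_of_maps_to (s := pre f B) (t := B) (g := f) (fun j hj => (mem_pre f B j).1 hj)]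
  refine Finset.prod_congr rfl fun k hk => Finset.prod_congr ?_ fun _ _ => rfl
  ext j
  rw [Finset.mem_filter, mem_pre, mem_fibre]
  constructor
  · rintro ⟨-, h⟩
    exact h
  · intro h
    exact ⟨h ▸ hk, h⟩

/-! ## The statuses of the pulled-back exits -/

section Sets

variable (ω : E₁ → Bool)

omit [DecidableEq ι] [DecidableEq ι'] [Fintype E₁] [DecidableEq E₁] in
/-- An exit of `u ∘ f` is merged iff its image is. -/
theorem mem_merged_comp (j : ι') : j ∈ merged Z₁ (u ∘ f) a₁ ω ↔ f j ∈ merged Z₁ u a₁ ω := by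
  rw [mem_merged, mem_merged]
  rfl

omit [DecidableEq ι'] [Fintype E₁] [DecidableEq E₁] in
/-- The merged exits of `u ∘ f` are the preimage of the merged exits of `u`. -/
theorem merged_comp : merged Z₁ (u ∘ f) a₁ ω = pre f (merged Z₁ u a₁ ω) := by
  ext j
  rw [mem_merged_comp, mem_pre]

omit [Fintype E₁] [DecidableEq E₁] [DecidableEq ι'] in
/-- The block of an exit of `u ∘ f` is the preimage of the block of its image. -/
theorem blk_comp (j : ι') : blk Z₁ (u ∘ f) a₁ ω j = pre f (blk Z₁ u a₁ ω (f j)) := by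
  ext l
  rw [mem_blk, mem_pre, mem_blk]
  rfl

omit [Fintype E₁] [DecidableEq E₁] in
/-- The blocks of `u ∘ f` are the nonempty preimages of the blocks of `u`. -/
theorem blocks_comp :
    blocks Z₁ (u ∘ f) a₁ ω = ((blocks Z₁ u a₁ ω).filter fun B => (pre f B).Nonempty).image (pre f) := by
  ext S
  rw [mem_blocks, Finset.mem_image]
  constructor
  · rintro ⟨j, hj, rfl⟩
    refine ⟨blk Z₁ u a₁ ω (f j), ?_, (blk_comp Z₁ u a₁ f ω j).symm⟩
    rw [Finset.mem_filter, mem_blocks]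
    refine ⟨⟨f j, hj, rfl⟩, ⟨j, ?_⟩⟩
    rw [mem_pre]
    exact self_mem_blk Z₁ u a₁ ω (f j) hj
  · rintro ⟨B, hB, rfl⟩
    rw [Finset.mem_filter, mem_blocks] at hB
    obtain ⟨⟨k, hk, rfl⟩, j, hj⟩ := hB
    rw [mem_pre] at hj
    refine ⟨j, ((mem_blk Z₁ u a₁ ω k (f j)).1 hj).1, ?_⟩
    rw [blk_comp, blk_eq_of_mem Z₁ u a₁ ω hj]

omit [Fintype E₁] [DecidableEq E₁] [DecidableEq ι'] in
/-- The preimage map is injective on the blocks with a nonempty preimage. -/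
theorem injOn_pre_blocks :
    Set.InjOn (pre f) (((blocks Z₁ u a₁ ω).filter fun B => (pre f B).Nonempty : Finset (Finset ι)) :
      Set (Finset ι)) := by
  intro B₁ hB₁ B₂ hB₂ h
  rw [Finset.coe_filter] at hB₁ hB₂
  obtain ⟨hB₁, j, hj⟩ := hB₁
  obtain ⟨hB₂, -⟩ := hB₂
  by_contra hne
  have hdis := blocks_pairwise Z₁ u a₁ ω B₁ hB₁ B₂ hB₂ hne
  rw [Finset.disjoint_left] at hdis
  have hj' : j ∈ pre f B₂ := h ▸ hj
  rw [mem_pre] at hj hj'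
  exact hdis hj hj'

end Sets

/-! ## THEOREM (EXIT FAMILIES) -/

omit [Fintype E₁] [DecidableEq E₁] [Fintype ι] [DecidableEq ι'] in
/-- The product of the exit vectors over a fibre is the exit vector of the product. -/
theorem prod_fibre_exitOf (ω : E₁ → Bool) (w : ι' → Vec6) (k : ι) :
    ∏ j ∈ fibre f k, exitOf (w j) (Z₁.Rd a₁ ((u ∘ f) j) ω) = exitOf (pull f w k) (Z₁.Rd a₁ (u k) ω) := by
  unfold pull
  rw [exitOf_prod]
  refine Finset.prod_congr rfl fun j hj => ?_
  rw [mem_fibre] at hj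
  rw [Function.comp_apply, hj]

omit [Fintype E₁] [DecidableEq E₁] in
/-- **The colouring term of the pulled-back family is the colouring term at the products over the fibres.** -/
theorem colTerm_comp (ω : E₁ → Bool) (w : ι' → Vec6) :
    colTerm Z₁ (u ∘ f) a₁ ω w = colTerm Z₁ u a₁ ω (pull f w) := by
  unfold colTerm
  rw [merged_comp, prod_pre, blocks_comp, Finset.prod_image (injOn_pre_blocks Z₁ u a₁ f ω)]
  congr 1
  · exact Finset.prod_congr rfl fun k _ => prod_fibre_exitOf Z₁ u a₁ f ω w k
  · rw [Finset.prod_filter]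
    refine Finset.prod_congr rfl fun B _ => ?_
    split_ifs with hB
    · rw [prod_pre]
      congr 1
      exact Finset.prod_congr rfl fun k _ => prod_fibre_exitOf Z₁ u a₁ f ω w k
    · rw [Finset.not_nonempty_iff_eq_empty] at hB
      rw [Finset.prod_eq_one, thR_one]
      intro k hk
      have hf : fibre f k = ∅ := by
        rw [Finset.eq_empty_iff_forall_notMem]
        intro j hj
        rw [mem_fibre] at hj
        have hjB : j ∈ pre f B := (mem_pre f B j).2 (hj ▸ hk)
        rw [hB] at hjB
        exact Finset.notMem_empty j hjB
      unfold pull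
      rw [hf, Finset.prod_empty, exitOf_one]

/-- **THEOREM (EXIT FAMILIES)**: the block map of the family `u ∘ f` is the block map of `u` at the products over
the fibres of `f`. -/
theorem blockMap_comp (w : ι' → Vec6) : blockMap Z₁ (u ∘ f) a₁ w = blockMap Z₁ u a₁ (pull f w) := by
  rw [blockMap_eq_sum_colTerm, blockMap_eq_sum_colTerm]
  exact Finset.sum_congr rfl fun ω _ => colTerm_comp Z₁ u a₁ f ω w

omit [Fintype ι] [DecidableEq ι'] in
/-- The products over the fibres of a cone family are cone members. -/
theorem inCone_pull (w : ι' → Vec6) (hw : ∀ j, InCone (w j)) (k : ι) : InCone (pull f w k) :=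
  inCone_prod _ w fun j _ => hw j

/-- **A cone host stays a cone host under any map of the exit indices**: re-indexing, identifying, multiplying or
omitting exits. -/
theorem coneHost_comp (h : ConeHost Z₁ u a₁) : ConeHost Z₁ (u ∘ f) a₁ := by
  intro w hw
  rw [blockMap_comp]
  exact h _ (inCone_pull f w hw)

/-- A cone host at a family through which `u'` factors is a cone host at `u'`. -/
theorem coneHost_of_factor (u' : ι' → V₁) (hf : ∀ j, u' j = u (f j)) (h : ConeHost Z₁ u a₁) :
    ConeHost Z₁ u' a₁ := by
  have hu' : u' = u ∘ f := funext hf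
  rw [hu']
  exact coneHost_comp Z₁ u a₁ f h

/-! ## Every vertex an exit, once -/

/-- **CONJECTURE (BLOCK MAP) for every family of exits is its instance with every vertex an exit, once.** -/
theorem coneHostAll_iff_id [Fintype V₁] [DecidableEq V₁] :
    ConeHostAll Z₁ a₁ ↔ ConeHost Z₁ (id : V₁ → V₁) a₁ := by
  constructor
  · intro h
    exact h id
  · intro h ι _ _ u
    exact coneHost_of_factor Z₁ id a₁ u u (fun _ => rfl) h

/-- A host is a cone host for every family of exits as soon as it is one for a family that hits every vertex. -/
theorem coneHostAll_of_surjective (hu : Function.Surjective u) (h : ConeHost Z₁ u a₁) : ConeHostAll Z₁ a₁ := by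
  intro ι' _ _ u'
  choose g hg using fun j => hu (u' j)
  exact coneHost_of_factor Z₁ u a₁ g u' (fun j => (hg j).symm) h

end MultiExit

end ZoneZ

end PercRepro
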